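import Mathlib
import HarnessLib
import Summits.HubbardSuperconductivity.HubbardSuperconductivity.Theorems.WeakCouplingBCSWcbcsKohnLuttingerB1gFormAWindow
import Summits.HubbardSuperconductivity.HubbardSuperconductivity.Theorems.WeakCouplingBCSDefsKlCertB1gWinZRecord
import Summits.HubbardSuperconductivity.HubbardSuperconductivity.Theorems.WeakCouplingBCSKlCertFillingLowerD010
import Summits.HubbardSuperconductivity.HubbardSuperconductivity.Theorems.WeakCouplingBCSKlCertFillingUpperD025

/-!
# Route `WeakCouplingBCS` — support item `WcbcsKohnLuttingerB1g` (stmt-HubbardSuperconductivity-0158):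
# the R2d certificate half in FORM (A) on the EXTENDED doping window `δ ∈ [0.10, 0.25]`

Seat cert-2's window record `klCertB1gWinZ` (29 μ-uniform boxes on `μ ∈ [-0.5725, -0.42749]`, margin
`γ_Z = 16905/1048576 ≈ 0.0161`, chaining onto `klCertB1gWinA.mub`) extends the certified chemical-potential window
of the `B1g` Kohn–Luttinger certificate to `μ ∈ [-0.5725, -0.1775]`.  This file reads it — in form (A), i.e. modulo
the FOUR named enclosure hypotheses `klCertB1gWin{Z,A,B,C}.EnclosuresB1g` — on the doping window `δ ∈ [0.10, 0.25]`:

* `muOfDoping_mem_window_d010_d025` — UNCONDITIONALLY `μ(δ) ∈ [-0.5725, -0.1775]` for `δ ∈ [0.10, 0.25]`, from the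
  certified fillings `n(-0.5725) ≤ 3/4` (`klfillU025_filling_le`, circumscribed tangent polygon) and
  `n(-0.1775) ≥ 9/10` (`klfillL010_filling_ge`), monotonicity and the `sInf` characterisation
  (`chemicalPotentialOfDensity_window`);
* `klCertB1gWinZ_b1g_le` (`decide +kernel`: every box of `klCertB1gWinZ` has `B1g` Ritz `rhohi ≤ -1/12`; the
  weakest is `-0.0842` at the `δ ≈ 0.25` end) and `klb1g_formA_b1g_le_window_d020_d025`;
* `klb1g_formA_r2d_certificate_d010_d025` — for every `δ ∈ [0.10, 0.25]`: (i) SELECTION for every `0 < U < 1`,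
  `χ ≠ B1g`: `channelInf ε₀ μ(δ) U B1g + (16905/1048576) U² ≤ channelInf ε₀ μ(δ) U χ`; (ii) ATTRACTION for every
  `U`: `channelInf ε₀ μ(δ) U B1g ≤ -(1/12) U²`; and `klb1g_formA_klCoefficient_ge_d010_d025` (`≥ 1/12`).
  (On the sub-window `δ ∈ [0.10, 0.20]` the sharper constants `437/16384` and `1/8` of
  `WeakCouplingBCSWcbcsKohnLuttingerB1gFormAWindow.lean` stand.)

The `δ ∈ [0.05, 0.10]` side waits for cert-2's `WinD` record(s); its window-end filling `n(-0.075) ≥ 19/20` is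
already in the tree (`klfillL005_filling_ge`).  Folklore glue; no definitions.
-/

noncomputable section

-- the tree's namespace `Summit.<Summit>.<Problem>.Theorems` repeats the summit name by design (D-0017)
set_option linter.dupNamespace false

namespace Summit.HubbardSuperconductivity.HubbardSuperconductivity.Theorems

open MeasureTheory Literature.MathematicalPhysics.QuantumLattice CwKLChiralWindow
open Summit.HubbardSuperconductivity.HubbardSuperconductivity.Theses.WeakCouplingBCS

/-- **`μ(δ) ∈ [-0.5725, -0.1775]` for every hole doping `δ ∈ [0.10, 0.25]`** (unconditional): the certified fillings
`n(-0.5725) ≤ 3/4` and `n(-0.1775) ≥ 9/10` put `[0.10, 0.25]` inside `[1 - n(-0.1775), 1 - n(-0.5725)]`, where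
`δ ↦ μ(δ)` inverts the strictly increasing filling (`chemicalPotentialOfDensity_window`). [folklore] -/
theorem muOfDoping_mem_window_d010_d025 :
    ∀ δ ∈ Set.Icc (0.10 : ℝ) 0.25,
      chemicalPotentialOfDensity (squareDispersion 1 0) (1 - δ) ∈ Set.Icc (-0.5725 : ℝ) (-0.1775) := by
  obtain ⟨-, -, -, H⟩ := chemicalPotentialOfDensity_window (μ₁ := (-0.1775 : ℝ)) (μ₂ := (-0.5725 : ℝ))
    (by norm_num) (by norm_num) (by norm_num)
  have hlo := klfillL010_filling_ge
  have hhi := klfillU025_filling_le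
  rw [show (-(71 / 400) : ℝ) = -0.1775 by norm_num] at hlo
  rw [show (-(229 / 400) : ℝ) = -0.5725 by norm_num] at hhi
  intro δ hδ
  refine H δ ⟨?_, ?_⟩
  · norm_num at hδ hlo ⊢; linarith [hδ.1]
  · norm_num at hδ hhi ⊢; linarith [hδ.2]

/-- Every box of `klCertB1gWinZ` has `B1g` Ritz upper bound `rhohi ≤ -1/12` (kernel decision). [folklore] -/
theorem klCertB1gWinZ_b1g_le : (klCertB1gWinZ.boxes.all fun bx => decide (bx.bB1g.rhohi ≤ -(1 / 12))) = true := by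
  decide +kernel

/-- **Certified attraction on `μ ∈ [-0.5725, -0.42749]`** (the `WinZ` window, `δ ≈ 0.20–0.25`), modulo its enclosures:
`channelInf ε₀ μ 1 B1g ≤ -1/12`. [cite: RaghuKivelsonScalapino2010, §III Fig. 2] -/
theorem klb1g_formA_b1g_le_window_d020_d025 (hZ : klCertB1gWinZ.EnclosuresB1g) :
    ∀ μ ∈ Set.Icc (-0.5725 : ℝ) (-0.42749), channelInf (squareDispersion 1 0) μ 1 D4Irrep.B1g ≤ -(1 / 12 : ℝ) := by
  have wZ := klb1gd_window_b1g_le klCertB1gWinZ klCertB1gWinZ_check hZ (1 / 12) klCertB1gWinZ_b1g_le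
  have e1 : (((klCertB1gWinZ).mub : ℚ) : ℝ) = -0.5725 := by
    show (((-229 : ℚ) / 400 : ℚ) : ℝ) = -0.5725
    push_cast; norm_num
  have e2 : (((klCertB1gWinZ).mua : ℚ) : ℝ) = -0.42749 := by
    show (((-42749 : ℚ) / 100000 : ℚ) : ℝ) = -0.42749
    push_cast; norm_num
  have ea : (((1 / 12 : ℚ) : ℚ) : ℝ) = (1 / 12 : ℝ) := by push_cast; norm_num
  rw [e1, e2, ea] at wZ
  exact wZ

/-- **R2d certificate half — form (A), δ-form on the extended window `δ ∈ [0.10, 0.25]`.** Modulo the certified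
enclosures of the four window records `WinZ, WinA, WinB, WinC`: for every `δ ∈ [0.10, 0.25]`, with
`μ(δ) = chemicalPotentialOfDensity ε₀ (1 - δ)`: (i) SELECTION — for every `0 < U < 1` and every `χ ≠ B1g`,
`channelInf ε₀ μ(δ) U B1g + (16905/1048576) U² ≤ channelInf ε₀ μ(δ) U χ`; (ii) ATTRACTION — for every real `U`,
`channelInf ε₀ μ(δ) U B1g ≤ -(1/12) U²`. [cite: RaghuKivelsonScalapino2010, §III Fig. 2] -/
theorem klb1g_formA_r2d_certificate_d010_d025 (hZ : klCertB1gWinZ.EnclosuresB1g) (hA : klCertB1gWinA.EnclosuresB1g)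
    (hB : klCertB1gWinB.EnclosuresB1g) (hC : klCertB1gWinC.EnclosuresB1g) :
    ∀ δ ∈ Set.Icc (0.10 : ℝ) 0.25,
      (∀ U ∈ Set.Ioo (0 : ℝ) 1, ∀ χ : D4Irrep, χ ≠ D4Irrep.B1g →
        channelInf (squareDispersion 1 0) (chemicalPotentialOfDensity (squareDispersion 1 0) (1 - δ)) U D4Irrep.B1g +
            (16905 / 1048576 : ℝ) * U ^ 2 ≤
          channelInf (squareDispersion 1 0) (chemicalPotentialOfDensity (squareDispersion 1 0) (1 - δ)) U χ) ∧
      (∀ U : ℝ, channelInf (squareDispersion 1 0) (chemicalPotentialOfDensity (squareDispersion 1 0) (1 - δ)) U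
          D4Irrep.B1g ≤ -(1 / 12 : ℝ) * U ^ 2) := by
  intro δ hδ
  have hμ := muOfDoping_mem_window_d010_d025 δ hδ
  set μ := chemicalPotentialOfDensity (squareDispersion 1 0) (1 - δ) with hμdef
  have hmo : μ ∈ Set.Ioo (-4 : ℝ) 0 := ⟨by linarith [hμ.1], by linarith [hμ.2]⟩
  -- the margins: `γ_Z = 16905/1048576 ≤ 437/16384 ≤ min (γ_A, γ_B, γ_C)`
  have hγZ : (16905 / 1048576 : ℝ) ≤ ((klCertB1gWinZ.gamma : ℚ) : ℝ) := by
    have hq : (16905 / 1048576 : ℚ) ≤ klCertB1gWinZ.gamma := by decide +kernel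
    have h' : ((16905 / 1048576 : ℚ) : ℝ) ≤ ((klCertB1gWinZ.gamma : ℚ) : ℝ) := by exact_mod_cast hq
    push_cast at h'
    exact h'
  have hγ : (16905 / 1048576 : ℝ) ≤ min (min ((klCertB1gWinA.gamma : ℚ) : ℝ) ((klCertB1gWinB.gamma : ℚ) : ℝ))
      ((klCertB1gWinC.gamma : ℚ) : ℝ) := by
    have hq : (16905 / 1048576 : ℚ) ≤ klCertB1gWinA.gamma ∧ (16905 / 1048576 : ℚ) ≤ klCertB1gWinB.gamma ∧
        (16905 / 1048576 : ℚ) ≤ klCertB1gWinC.gamma := by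
      refine ⟨?_, ?_, ?_⟩ <;> decide +kernel
    obtain ⟨h1, h2, h3⟩ := hq
    have h1' : ((16905 / 1048576 : ℚ) : ℝ) ≤ ((klCertB1gWinA.gamma : ℚ) : ℝ) := by exact_mod_cast h1
    have h2' : ((16905 / 1048576 : ℚ) : ℝ) ≤ ((klCertB1gWinB.gamma : ℚ) : ℝ) := by exact_mod_cast h2
    have h3' : ((16905 / 1048576 : ℚ) : ℝ) ≤ ((klCertB1gWinC.gamma : ℚ) : ℝ) := by exact_mod_cast h3
    push_cast at h1' h2' h3'
    exact le_min (le_min h1' h2') h3'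
  -- the `WinZ` window statement with explicit ends
  have wZ := klCertB1gWinZ_window_U hZ
  have e1 : (((klCertB1gWinZ).mub : ℚ) : ℝ) = -0.5725 := by
    show (((-229 : ℚ) / 400 : ℚ) : ℝ) = -0.5725
    push_cast; norm_num
  have e2 : (((klCertB1gWinZ).mua : ℚ) : ℝ) = -0.42749 := by
    show (((-42749 : ℚ) / 100000 : ℚ) : ℝ) = -0.42749
    push_cast; norm_num
  rw [e1, e2] at wZ
  refine ⟨fun U hU χ hχ => ?_, fun U => ?_⟩
  · by_cases hcut : μ ≤ -0.42749
    · have h := wZ μ ⟨hμ.1, hcut⟩ U hU χ hχ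
      nlinarith [sq_nonneg U]
    · have h := klb1g_window_d010_d020 hA hB hC μ ⟨by linarith, hμ.2⟩ U hU χ hχ
      nlinarith [sq_nonneg U]
  · have hfin : IsFiniteMeasure (fermiCurveMeasure (squareDispersion 1 0) μ) :=
      stub_klFiniteMeasure stub_klGradient stub_klHausdorffFinite μ hmo
    have hinv := stub_klD4Invariant stub_klGradient μ hmo
    have hhom : channelInf (squareDispersion 1 0) μ U D4Irrep.B1g =
        U ^ 2 * channelInf (squareDispersion 1 0) μ 1 D4Irrep.B1g :=
      klhs_channelInf_sq stub_klKernelHS hmo U D4Irrep.B1g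
        (fun ψ hψ => (stub_klMeanZero _ _ hfin hinv D4Irrep.B1g ψ (by decide) hψ).2)
    have h1 : channelInf (squareDispersion 1 0) μ 1 D4Irrep.B1g ≤ -(1 / 12 : ℝ) := by
      by_cases hcut : μ ≤ -0.42749
      · exact klb1g_formA_b1g_le_window_d020_d025 hZ μ ⟨hμ.1, hcut⟩
      · have := klb1g_formA_b1g_le_window hA hB hC μ ⟨by linarith, hμ.2⟩
        linarith
    rw [hhom]
    nlinarith [sq_nonneg U]

/-- **Positivity of the Kohn–Luttinger coefficient on the extended window, form (A)**: for every `δ ∈ [0.10, 0.25]`,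
`1/12 ≤ -channelInf ε₀ μ(δ) 1 B1g` (the onset leaf's `klCoefficientB1g(μ_δ)`). [cite: RaghuKivelsonScalapino2010, §III Fig. 2] -/
theorem klb1g_formA_klCoefficient_ge_d010_d025 (hZ : klCertB1gWinZ.EnclosuresB1g) (hA : klCertB1gWinA.EnclosuresB1g)
    (hB : klCertB1gWinB.EnclosuresB1g) (hC : klCertB1gWinC.EnclosuresB1g) :
    ∀ δ ∈ Set.Icc (0.10 : ℝ) 0.25,
      (1 / 12 : ℝ) ≤ -channelInf (squareDispersion 1 0) (chemicalPotentialOfDensity (squareDispersion 1 0) (1 - δ)) 1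
        D4Irrep.B1g := by
  intro δ hδ
  have h := (klb1g_formA_r2d_certificate_d010_d025 hZ hA hB hC δ hδ).2 1
  norm_num at h ⊢
  linarith

end Summit.HubbardSuperconductivity.HubbardSuperconductivity.Theorems

end
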